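import Mathlib
import Literature.Analysis.FluidPDE.DuchonRobertLionsEnergyEquality
import Literature.Analysis.FluidPDE.StatisticalSolutionEnergyEq
import Literature.Analysis.FluidPDE.NSUniqueness2DProofs
import Literature.Analysis.FluidPDE.DissipationAnomalyProofs
import Literature.Analysis.FluidPDE.Ferrari1993EnergyIdentity
import Literature.Analysis.FluidPDE.NSEnergyClassEnergyEquality
import Literature.Analysis.FluidPDE.LerayHopfProofs
import HarnessLib

/-!
# The high-band energy budget and flux ceiling for Leray–Hopf solutions of the periodic Navier–Stokes equations

HONEST FRAMING (cell `ns-blowup`, seat `ns-blowup-circuit` g6, human ruling D-0035): this cell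
ATTEMPTS the negative direction of the Clay problem; nothing here is a claim about Navier–Stokes
blow-up. WHAT THIS IS NOT: not a regularity criterion, not blow-up evidence — it is the energy
bookkeeping of the HIGH Fourier band of a weak solution (Foias–Manley–Rosa–Temam 2001, Ch. V §5.1,
(5.13)–(5.19), there formal), i.e. the «coherence law» of memo
`run/shared/lean/pub/ns-blowup/CIRCUIT-OBSTRUCTIONS.md` §E.3b/§L.6, typed so far only for finite
exact-coefficient Galerkin systems (`FluidComputer/GalerkinFluxCeiling.lean`, p437361), here for the
Navier–Stokes equations THEMSELVES on `T^d` (true bilinear term, nothing discarded, `f ∈ L¹(0,T;L²)`,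
`L²` data, any `d`). Objects (all the tree's): `Torus.IsLerayHopfOn` (`FluidPDE/LerayHopf`),
`P_M = Torus.fourierTruncate M` (ball `|k|² ≤ M²`), the HIGH BAND `Q_M v := v - P_M v`,
`tail_M = Torus.tailGradNormSq M` (`4π²∑_{|k|>M}|k|²‖v̂(k)‖²`) and the low-band ℓ¹-strain
`K_M(v) = Torus.truncDerivBound M v = ∑ᵢ∑_{|k|≤M} 2π|kᵢ|‖v̂(k)‖` (`FluidPDE/StatisticalSolutionEnergyEq`).

## What is typed (theorems only)
§1 slices `v ∈ L²(T^d)`: `integral_norm_sq_eq_add_highBand` (Pythagoras),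
`eGradNormSq_eq_add_tailGradNormSq` (`‖∇v‖₂² = ‖∇P_M v‖₂² + tail_M`),
`abs_integral_inner_highBand_convect_le` — **FLUX CEILING** `|∫⟪Q_M v,(v·∇)P_M v⟫| ≤ K_M(v)‖Q_M v‖₂‖v‖₂`,
`integral_inner_convect_fourierTruncate_self_eq_highBand` (the low band does no work on itself, weakly
div-free `v`), `highBand_source_le`, `highBand_poincare` (`4π²(M²+1)‖Q_M v‖₂² ≤ tail_M(v)`).
§2 along a Leray–Hopf solution, every `M`, `t ∈ (0,T]`: `highBand_energy_budget` —
`½‖Q_M u(t)‖² + ν∫₀ᵗ tail_M(u) ≤ ½‖Q_M u₀‖² + ∫_{(0,t]} (∫⟪f, Q_M u⟫ - ∫⟪Q_M u,(u·∇)P_M u⟫)`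
(energy inequality from `0` minus ½ × the level-`M` identity
`Torus.IsLerayHopfOn.integral_inner_fourierTruncate_self_eq`), and
`lintegral_highBand_le_lintegral_tail` (`4π²(M²+1)∫₀ᵗ‖Q_M u‖₂² ≤ ∫₀ᵗ tail_M(u)`, in `ℝ≥0∞`).

READING (memo §E.3b, for NS itself): the energy above wavenumber `M` of a periodic Leray–Hopf flow
is fed ONLY by low-band straining, at rate ≤ `K_M(u)` (≤ Bernstein `C_d M^{1+d/2}‖P_M u‖₂`) times
`‖Q_M u‖₂‖u‖₂`, plus the force's work on the high band, and drained at rate `≥ 4π²ν(M²+1)`: raising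
`‖Q_M u‖` needs `K_M ≳ 4π²νM²·‖Q_M u‖₂/‖u‖₂` — the memo's `G_n ≥ νN_n/√E_n`, no model in between.
Honest limits: torus; budget from `t = 0` only (the a.e.-intermediate-time version and the pointwise
ceiling for continuous-energy solutions are not in this file).
-/

noncomputable section

open MeasureTheory Set Filter UnitAddTorus Function
open scoped ENNReal NNReal InnerProductSpace RealInnerProductSpace

namespace Summit.NavierStokesRegularity.FluidComputer.TorusHighBandFluxCeiling

open Literature.Analysis Literature.Analysis.FunctionSpaces Literature.Analysis.FluidPDE

variable {d : Type*} [Fintype d] [DecidableEq d]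

/-! ## §1 Slice lemmas -/
section Slice

/-- **Pythagoras for the Fourier truncation**: for `v ∈ L²(T^d)`,
`∫‖v‖² = ∫‖P_M v‖² + ∫‖v - P_M v‖²` (Parseval: the coefficients of `P_M v` are those of `v` on
the ball and `0` outside, those of `v - P_M v` the complementary ones). [folklore] -/
theorem integral_norm_sq_eq_add_highBand {v : UnitAddTorus d → EuclideanSpace ℝ d}
    (hv : MemLp v 2 volume) (M : ℕ) :
    ∫ x, ‖v x‖ ^ 2 = (∫ x, ‖Torus.fourierTruncate M v x‖ ^ 2) +
      ∫ x, ‖v x - Torus.fourierTruncate M v x‖ ^ 2 := by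
  classical
  have hint : Integrable v volume := hv.integrable one_le_two
  set c : (d → ℤ) → ℝ := fun k => ‖mFourierCoeff (EuclideanSpace.complexify ∘ v) k‖ ^ 2 with hc
  have hsub : MemLp (v - Torus.fourierTruncate M v) 2 volume :=
    hv.sub (Torus.memLp_fourierTruncate M v 2)
  have h1 : HasSum c (∫ x, ‖v x‖ ^ 2) := Torus.hasSum_sq_norm_mFourierCoeff_complexify hv
  have h2 : HasSum (fun k => ‖mFourierCoeff (EuclideanSpace.complexify ∘ (v - Torus.fourierTruncate M v)) k‖ ^ 2)
      (∫ x, ‖(v - Torus.fourierTruncate M v) x‖ ^ 2) :=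
    Torus.hasSum_sq_norm_mFourierCoeff_complexify hsub
  have hcoef : ∀ k, ‖mFourierCoeff (EuclideanSpace.complexify ∘ (v - Torus.fourierTruncate M v)) k‖ ^ 2 =
      if k ∈ Torus.freqBall M then 0 else c k := by
    intro k
    rw [Torus.complexify_comp_sub, Torus.mFourierCoeff_sub (Torus.integrable_complexify_comp hint)
      (Torus.integrable_complexify_comp (Torus.isSmooth_fourierTruncate M v).integrable),
      Torus.mFourierCoeff_fourierTruncate hint]
    split_ifs <;> simp [hc]
  simp_rw [hcoef] at h2
  have h3 : ∫ x, ‖Torus.fourierTruncate M v x‖ ^ 2 = ∑ k ∈ Torus.freqBall M, c k :=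
    Torus.integral_norm_sq_fourierTruncate hint M
  have h4 : HasSum (fun k => if k ∈ Torus.freqBall M then c k else 0) (∑ k ∈ Torus.freqBall M, c k) := by
    have h : HasSum (fun k => if k ∈ Torus.freqBall M then c k else 0)
        (∑ k ∈ Torus.freqBall M, (if k ∈ Torus.freqBall M then c k else 0)) :=
      hasSum_sum_of_ne_finset_zero (fun k hk => if_neg hk)
    rwa [Finset.sum_congr rfl (g := c) (fun k hk => if_pos hk)] at h
  have h5 : HasSum (fun k => (if k ∈ Torus.freqBall M then c k else 0) +
      (if k ∈ Torus.freqBall M then 0 else c k)) ((∑ k ∈ Torus.freqBall M, c k) +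
        ∫ x, ‖(v - Torus.fourierTruncate M v) x‖ ^ 2) := h4.add h2
  have h6 : (fun k => (if k ∈ Torus.freqBall M then c k else 0) +
      (if k ∈ Torus.freqBall M then 0 else c k)) = c := by
    funext k; split_ifs <;> simp
  rw [h6] at h5
  rw [h1.unique h5, h3]; rfl

/-- **Enstrophy splits across the band edge**: `‖∇v‖₂² = ‖∇P_M v‖₂² + tail_M(v)` in `ℝ≥0∞`
(`tail_M(v) = 4π² ∑_{|k|>M} |k|² ‖v̂(k)‖²`, `Torus.tailGradNormSq`), for integrable `v`. [folklore] -/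
theorem eGradNormSq_eq_add_tailGradNormSq {v : UnitAddTorus d → EuclideanSpace ℝ d}
    (hv : Integrable v volume) (M : ℕ) :
    Torus.eGradNormSq v = Torus.eGradNormSq (Torus.fourierTruncate M v) +
      FluidPDE.Torus.tailGradNormSq M v := by
  classical
  rw [Torus.eGradNormSq_eq_tsum v, FluidPDE.Torus.eGradNormSq_fourierTruncate_eq_sum hv M,
    FluidPDE.Torus.tailGradNormSq, ← mul_add]
  congr 1
  exact (ENNReal.sum_add_tsum_compl (Torus.freqBall M) fun k =>
    ENNReal.ofReal (Torus.freqNormSq k) * ‖mFourierCoeff (EuclideanSpace.complexify ∘ v) k‖ₑ ^ 2).symm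

omit [DecidableEq d] in
/-- Cauchy–Schwarz for norms of two `L²` fields on the torus:
`∫ ‖a‖‖b‖ ≤ (∫‖a‖²)^{1/2} (∫‖b‖²)^{1/2}`. [folklore] -/
theorem integral_norm_mul_norm_le_sqrt {a b : UnitAddTorus d → EuclideanSpace ℝ d}
    (ha : MemLp a 2 volume) (hb : MemLp b 2 volume) :
    ∫ x, ‖a x‖ * ‖b x‖ ≤ Real.sqrt (∫ x, ‖a x‖ ^ 2) * Real.sqrt (∫ x, ‖b x‖ ^ 2) := by
  have h2 : ENNReal.ofReal (2 : ℝ) = 2 := by norm_num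
  have ha' : MemLp a (ENNReal.ofReal 2) volume := by rw [h2]; exact ha
  have hb' : MemLp b (ENNReal.ofReal 2) volume := by rw [h2]; exact hb
  have h := integral_mul_norm_le_Lp_mul_Lq Real.HolderConjugate.two_two ha' hb'
  simp only [Real.rpow_two] at h
  rwa [Real.sqrt_eq_rpow, Real.sqrt_eq_rpow]

/-- **THE FLUX CEILING (slice form).** For `v ∈ L²(T^d)` and every band edge `M`:
`|∫⟪v - P_M v, (v·∇)P_M v⟫| ≤ K_M(v) · (∫‖v - P_M v‖²)^{1/2} · (∫‖v‖²)^{1/2}`,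
`K_M(v) = ∑ᵢ∑_{|k|≤M} 2π|kᵢ|‖v̂(k)‖` the low-band ℓ¹-strain (`Torus.truncDerivBound`), because
`‖(v·∇)P_M v (x)‖ ≤ ‖v x‖ K_M(v)` pointwise (`Torus.norm_fderiv_fourierTruncate_apply_le`) and
Cauchy–Schwarz. Navier–Stokes reading: the only channel feeding the band `|k| > M` from the band
`|k| ≤ M` is straining by the low-band velocity gradient. [folklore] -/
theorem abs_integral_inner_highBand_convect_le {v : UnitAddTorus d → EuclideanSpace ℝ d}
    (hv : MemLp v 2 volume) (M : ℕ) :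
    |∫ x, ⟪v x - Torus.fourierTruncate M v x, Torus.convect v (Torus.fourierTruncate M v) x⟫| ≤
      FluidPDE.Torus.truncDerivBound M v * Real.sqrt (∫ x, ‖v x - Torus.fourierTruncate M v x‖ ^ 2) *
        Real.sqrt (∫ x, ‖v x‖ ^ 2) := by
  set Φ := Torus.fourierTruncate M v with hΦ
  have hsub : MemLp (v - Φ) 2 volume := hv.sub (Torus.memLp_fourierTruncate M v 2)
  have hK := FluidPDE.Torus.truncDerivBound_nonneg M v
  have hpt : ∀ x, ‖⟪v x - Φ x, Torus.convect v Φ x⟫‖ ≤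
      FluidPDE.Torus.truncDerivBound M v * (‖(v - Φ) x‖ * ‖v x‖) := by
    intro x; rw [Real.norm_eq_abs]
    calc |⟪v x - Φ x, Torus.convect v Φ x⟫| ≤ ‖v x - Φ x‖ * ‖Torus.convect v Φ x‖ :=
          abs_real_inner_le_norm _ _
      _ ≤ ‖v x - Φ x‖ * (‖v x‖ * FluidPDE.Torus.truncDerivBound M v) := by
          gcongr; exact FluidPDE.Torus.norm_fderiv_fourierTruncate_apply_le M v x (v x)
      _ = FluidPDE.Torus.truncDerivBound M v * (‖(v - Φ) x‖ * ‖v x‖) := by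
          rw [Pi.sub_apply]; ring
  have hprod : Integrable (fun x => ‖(v - Φ) x‖ * ‖v x‖) volume := hsub.norm.integrable_mul hv.norm
  have h1 : |∫ x, ⟪v x - Φ x, Torus.convect v Φ x⟫| ≤
      ∫ x, FluidPDE.Torus.truncDerivBound M v * (‖(v - Φ) x‖ * ‖v x‖) := by
    rw [← Real.norm_eq_abs]
    exact norm_integral_le_of_norm_le (hprod.const_mul _) (ae_of_all _ hpt)
  rw [integral_const_mul] at h1
  refine h1.trans ?_
  rw [mul_assoc]
  have h3 := integral_norm_mul_norm_le_sqrt hsub hv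
  exact mul_le_mul_of_nonneg_left (by simpa only [Pi.sub_apply] using h3) hK

/-- **The low band does no work on itself**: for a weakly divergence-free `v ∈ L²(T^d)`,
`∫⟪v, (v·∇)P_M v⟫ = ∫⟪v - P_M v, (v·∇)P_M v⟫`, since `∫⟪P_M v, (v·∇)P_M v⟫ = 0`
(`Torus.integral_inner_self_convect_eq_zero_of_isWeaklyDivFree`). [folklore] -/
theorem integral_inner_convect_fourierTruncate_self_eq_highBand
    {v : UnitAddTorus d → EuclideanSpace ℝ d} (hv : MemLp v 2 volume)
    (hdiv : Torus.IsWeaklyDivFree v) (M : ℕ) :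
    ∫ x, ⟪v x, Torus.convect v (Torus.fourierTruncate M v) x⟫ =
      ∫ x, ⟪v x - Torus.fourierTruncate M v x, Torus.convect v (Torus.fourierTruncate M v) x⟫ := by
  set Φ := Torus.fourierTruncate M v with hΦ
  have hs : Torus.IsSmooth Φ := Torus.isSmooth_fourierTruncate M v
  have hΦm : MemLp Φ 2 volume := Torus.memLp_fourierTruncate M v 2
  have hvΦ : MemLp (v - Φ) 2 volume := hv.sub hΦm
  have hpt : ∀ x, ⟪v x, Torus.convect v Φ x⟫ =
      ⟪(v - Φ) x, Torus.convect v Φ x⟫ + ⟪Φ x, Torus.convect v Φ x⟫ := by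
    intro x; rw [Pi.sub_apply, inner_sub_left]; ring
  simp_rw [hpt]
  rw [integral_add (FluidPDE.Torus.integrable_inner_convect' hvΦ hv hs)
      (FluidPDE.Torus.integrable_inner_convect' hΦm hv hs),
    FluidPDE.Torus.integral_inner_self_convect_eq_zero_of_isWeaklyDivFree hdiv hs, add_zero]
  rfl

omit [DecidableEq d] in
/-- Cauchy–Schwarz for a pairing of two `L²` fields: `|∫⟪F, w⟫| ≤ (∫‖F‖²)^{1/2}(∫‖w‖²)^{1/2}`. [folklore] -/
theorem abs_integral_inner_le_sqrt_mul_sqrt {F w : UnitAddTorus d → EuclideanSpace ℝ d}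
    (hF : MemLp F 2 volume) (hw : MemLp w 2 volume) :
    |∫ x, ⟪F x, w x⟫| ≤ Real.sqrt (∫ x, ‖F x‖ ^ 2) * Real.sqrt (∫ x, ‖w x‖ ^ 2) := by
  have hprod : Integrable (fun x => ‖F x‖ * ‖w x‖) volume := hF.norm.integrable_mul hw.norm
  have h1 : |∫ x, ⟪F x, w x⟫| ≤ ∫ x, ‖F x‖ * ‖w x‖ := by
    rw [← Real.norm_eq_abs]
    exact norm_integral_le_of_norm_le hprod (ae_of_all _ fun x => norm_inner_le_norm _ _)
  exact h1.trans (integral_norm_mul_norm_le_sqrt hF hw)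

/-- **The source term of the high-band budget is bounded by the flux ceiling plus the work**:
for `v, F ∈ L²(T^d)` and every band edge `M`,
`∫⟪F, v - P_M v⟫ - ∫⟪v - P_M v, (v·∇)P_M v⟫ ≤ (K_M(v)·(∫‖v‖²)^{1/2} + (∫‖F‖²)^{1/2}) · (∫‖v - P_M v‖²)^{1/2}`.
Applied slice-wise (`v = u(s)`, `F = f(s)`) this bounds the integrand of `highBand_energy_budget`. [folklore] -/
theorem highBand_source_le {v F : UnitAddTorus d → EuclideanSpace ℝ d} (hv : MemLp v 2 volume)
    (hF : MemLp F 2 volume) (M : ℕ) :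
    (∫ x, ⟪F x, v x - Torus.fourierTruncate M v x⟫) -
        ∫ x, ⟪v x - Torus.fourierTruncate M v x, Torus.convect v (Torus.fourierTruncate M v) x⟫ ≤
      (FluidPDE.Torus.truncDerivBound M v * Real.sqrt (∫ x, ‖v x‖ ^ 2) +
          Real.sqrt (∫ x, ‖F x‖ ^ 2)) *
        Real.sqrt (∫ x, ‖v x - Torus.fourierTruncate M v x‖ ^ 2) := by
  have hsub : MemLp (v - Torus.fourierTruncate M v) 2 volume :=
    hv.sub (Torus.memLp_fourierTruncate M v 2)
  have h1 := abs_integral_inner_le_sqrt_mul_sqrt hF hsub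
  have h2 := abs_integral_inner_highBand_convect_le hv M
  simp only [Pi.sub_apply] at h1
  have h1' := (le_abs_self _).trans h1
  have h2' := (neg_le_abs _).trans h2
  nlinarith [h1', h2']

/-- **Tail Poincaré**, real form: `4π²(M²+1) ∫‖v - P_M v‖² ≤ tail_M(v)` for `v ∈ L²` with finite
tail enstrophy (`Torus.lintegral_enorm_sq_fourierTruncate_sub_le`; integrality of the lattice:
`|k|² ≥ M² + 1` off the ball). Hence the dissipation term of the budget drains the high band at rate
`≥ 4π²ν(M²+1)`. [folklore] -/
theorem highBand_poincare {v : UnitAddTorus d → EuclideanSpace ℝ d} (hv : MemLp v 2 volume) (M : ℕ)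
    (htail : FluidPDE.Torus.tailGradNormSq M v ≠ ⊤) :
    4 * Real.pi ^ 2 * ((M : ℝ) ^ 2 + 1) * ∫ x, ‖v x - Torus.fourierTruncate M v x‖ ^ 2 ≤
      (FluidPDE.Torus.tailGradNormSq M v).toReal := by
  have h := FluidPDE.Torus.integral_norm_sq_fourierTruncate_sub_le hv M htail
  have hsym : ∫ x, ‖v x - Torus.fourierTruncate M v x‖ ^ 2 =
      ∫ x, ‖Torus.fourierTruncate M v x - v x‖ ^ 2 :=
    integral_congr_ae (ae_of_all _ fun x => by simp only [norm_sub_rev])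
  rw [hsym]
  have hpos : 0 < 4 * Real.pi ^ 2 * ((M : ℝ) ^ 2 + 1) := by positivity
  rw [le_div_iff₀ hpos] at h
  linarith

end Slice

/-! ## §2 Along a Leray–Hopf solution: the high-band energy budget -/

section LerayHopf

variable {T ν : ℝ} {f u : ℝ → UnitAddTorus d → EuclideanSpace ℝ d} {u₀ : UnitAddTorus d → EuclideanSpace ℝ d}

/-- Kinetic energy of the high band: `½∫‖v - P_M v‖² = ½∫‖v‖² - ½∫⟪P_M v, P_M v⟫` (`v ∈ L²`). [folklore] -/
theorem kineticEnergy_highBand_eq {v : UnitAddTorus d → EuclideanSpace ℝ d} (hv : MemLp v 2 volume)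
    (M : ℕ) :
    Torus.kineticEnergy (v - Torus.fourierTruncate M v) = Torus.kineticEnergy v -
      2⁻¹ * ∫ x, ⟪Torus.fourierTruncate M v x, Torus.fourierTruncate M v x⟫ := by
  unfold Torus.kineticEnergy
  have h := integral_norm_sq_eq_add_highBand hv M
  have hin : ∫ x, ⟪Torus.fourierTruncate M v x, Torus.fourierTruncate M v x⟫ =
      ∫ x, ‖Torus.fourierTruncate M v x‖ ^ 2 :=
    integral_congr_ae (ae_of_all _ fun x => real_inner_self_eq_norm_sq _)
  rw [hin, h]; simp only [Pi.sub_apply]; ring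

/-- **HIGH-BAND ENERGY BUDGET of a Leray–Hopf solution of the periodic Navier–Stokes equations.**
Let `u` be a Leray–Hopf weak solution on `T^d × [0,T)`, `T > 0`, viscosity `ν`, jointly measurable
force `f ∈ L¹(0,T; L²)`, datum `u₀ ∈ L²`; `P_M` the Fourier truncation at `|k| ≤ M`, `Q_M = 1 - P_M`.
Then for every `t ∈ (0, T]`
`½‖Q_M u(t)‖² + ν ∫₀ᵗ tail_M(u(s)) ds ≤ ½‖Q_M u₀‖²
   + ∫_{(0,t]} ( ∫⟪f(s), Q_M u(s)⟫ - ∫⟪Q_M u(s), (u(s)·∇)P_M u(s)⟫ ) ds`,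
`tail_M = Torus.tailGradNormSq M` (`= ‖∇Q_M u‖₂²`). Proof: the energy inequality from `0`
(`energy_ineq_zero`) minus one half of the level-`M` identity
`Torus.IsLerayHopfOn.integral_inner_fourierTruncate_self_eq` (whose flux splits by
`Torus.flux_fourierTruncate_self_split`), the enstrophy split `eGradNormSq_eq_add_tailGradNormSq`,
Pythagoras, and `∫⟪P_M u,(u·∇)P_M u⟫ = 0` on the weakly divergence-free slices. The only source
term of the high band is the straining pairing `-∫⟪Q_M u,(u·∇)P_M u⟫` (flux ceiling:
`abs_integral_inner_highBand_convect_le`). Printed ancestor: Foias–Manley–Rosa–Temam 2001,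
Ch. V §5.1, (5.13)–(5.19) (`d/dt e(u_{κ,∞}) + νE(u_{κ,∞}) ≤ e_κ(u)`, stated formally for the force in
the low modes); here with the work term, for the tree's `Torus.IsLerayHopfOn`, as an integrated
inequality from `t = 0`. [cite: FoiasManleyRosaTemam2001, Ch. V §5.1 (5.19)] -/
theorem highBand_energy_budget (hu : FluidPDE.Torus.IsLerayHopfOn T ν f u₀ u) (hT : 0 < T)
    (hfm : AEStronglyMeasurable (Torus.stLift f) (volume.restrict (Ioo 0 T ×ˢ univ)))
    (hf : FluidPDE.Torus.MemLqLp 1 2 f (Ioo 0 T)) (hu₀ : MemLp u₀ 2 volume) (M : ℕ) {t : ℝ}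
    (ht : t ∈ Ioc 0 T) :
    Torus.kineticEnergy (u t - Torus.fourierTruncate M (u t)) +
        ν * (∫⁻ s in Ioo 0 t, FluidPDE.Torus.tailGradNormSq M (u s)).toReal ≤
      Torus.kineticEnergy (u₀ - Torus.fourierTruncate M u₀) +
        ∫ s in Ioc 0 t, ((∫ x, ⟪f s x, u s x - Torus.fourierTruncate M (u s) x⟫) -
          ∫ x, ⟪u s x - Torus.fourierTruncate M (u s) x,
            Torus.convect (u s) (Torus.fourierTruncate M (u s)) x⟫) := by
  classical
  set P : ℝ → UnitAddTorus d → EuclideanSpace ℝ d := fun s => Torus.fourierTruncate M (u s) with hP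
  have htT : Ioo 0 t ⊆ Ioo 0 T := Ioo_subset_Ioo le_rfl ht.2
  have hle : volume.restrict (Ioo 0 t) ≤ volume.restrict (Ioo 0 T) := Measure.restrict_mono htT le_rfl
  have hmem : ∀ s ∈ Icc 0 T, MemLp (u s) 2 volume := hu.memLp
  have hut : MemLp (u t) 2 volume := hmem t ⟨ht.1.le, ht.2⟩
  -- ### (1) the energy inequality from `0`
  have hE := hu.energy_ineq_zero t ⟨ht.1.le, ht.2⟩
  -- ### (2) the level-`M` identity and the split of its flux
  obtain ⟨hΦint, hId⟩ := hu.integral_inner_fourierTruncate_self_eq hT hfm hf hu₀ M ht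
  have hG := (hu.tendsto_setIntegral_toReal_eGradNormSq_fourierTruncate ht).1 M
  have hWP := (hu.tendsto_setIntegral_work_fourierTruncate hfm hf ht).1 M
  -- a.e. slice facts on `(0, t]`
  have hfs2 : ∀ᵐ s ∂(volume.restrict (Ioc 0 t)), MemLp (f s) 2 volume := by
    have h2 : ∀ᵐ s ∂(volume.restrict (Ioo 0 t)), MemLp (f s) 2 volume := ae_mono hle hf.1
    rwa [Measure.restrict_congr_set Ioo_ae_eq_Ioc] at h2
  have hsplit : ∀ᵐ s ∂(volume.restrict (Ioc 0 t)),
      (∫ x, (⟪u s x, Torus.convect (u s) (P s) x⟫ + ν * ⟪u s x, Torus.laplacian (P s) x⟫ +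
          ⟪f s x, P s x⟫)) =
        (∫ x, ⟪u s x, Torus.convect (u s) (P s) x⟫) - ν * (Torus.eGradNormSq (P s)).toReal +
          ∫ x, ⟪f s x, P s x⟫ := by
    filter_upwards [hfs2, ae_restrict_mem measurableSet_Ioc] with s hfs' hs
    exact FluidPDE.Torus.flux_fourierTruncate_self_split (hmem s ⟨hs.1.le, hs.2.trans ht.2⟩)
      (hfs'.integrable one_le_two) ν M
  -- the convective flux is integrable on `(0, t]`
  have hC : IntegrableOn (fun s => ∫ x, ⟪u s x, Torus.convect (u s) (P s) x⟫) (Ioc 0 t) := by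
    have h := (hΦint.add (hG.const_mul ν)).sub hWP
    refine h.congr ?_
    filter_upwards [hsplit] with s hs
    simp only [Pi.add_apply, Pi.sub_apply]
    rw [hs]; ring
  have hId' : ∫ s in Ioc 0 t, (∫ x, (⟪u s x, Torus.convect (u s) (P s) x⟫ +
      ν * ⟪u s x, Torus.laplacian (P s) x⟫ + ⟪f s x, P s x⟫)) =
      (∫ s in Ioc 0 t, ∫ x, ⟪u s x, Torus.convect (u s) (P s) x⟫) -
        ν * (∫ s in Ioc 0 t, (Torus.eGradNormSq (P s)).toReal) +
        ∫ s in Ioc 0 t, ∫ x, ⟪f s x, P s x⟫ := by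
    have hG' : Integrable (fun s => ν * (Torus.eGradNormSq (P s)).toReal)
        (volume.restrict (Ioc 0 t)) := hG.const_mul ν
    have hWP' : Integrable (fun s => ∫ x, ⟪f s x, P s x⟫) (volume.restrict (Ioc 0 t)) := hWP
    have h1 : Integrable (fun s => (∫ x, ⟪u s x, Torus.convect (u s) (P s) x⟫) -
        ν * (Torus.eGradNormSq (P s)).toReal) (volume.restrict (Ioc 0 t)) := hC.sub hG'
    rw [integral_congr_ae hsplit, integral_add h1 hWP', integral_sub hC hG', integral_const_mul]
  -- ### (3) the work against `u` itself
  have hWu : IntegrableOn (fun s => ∫ x, ⟪f s x, u s x⟫) (Ioc 0 t) := by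
    have h := FluidPDE.Torus.WeakNSEnergyClass.integrableOn_work_L1L2 hu.weak hu.energy_bound
      hu.memLp hfm hf
    have h' : IntegrableOn (fun s => ∫ x, ⟪f s x, u s x⟫) (Ioo 0 t) := h.mono_set htT
    rwa [IntegrableOn, Measure.restrict_congr_set Ioo_ae_eq_Ioc] at h'
  have hWu_eq : ∫ τ in (0 : ℝ)..t, ∫ x, ⟪f τ x, u τ x⟫ = ∫ s in Ioc 0 t, ∫ x, ⟪f s x, u s x⟫ :=
    intervalIntegral.integral_of_le ht.1.le
  -- ### (4) the dissipation splits across the band edge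
  have hmeasP : AEMeasurable (fun s => Torus.eGradNormSq (P s)) (volume.restrict (Ioo 0 t)) :=
    (hu.aemeasurable_eGradNormSq_fourierTruncate M).mono_measure hle
  have hDsplit : ∫⁻ s in Ioo 0 t, Torus.eGradNormSq (u s) =
      (∫⁻ s in Ioo 0 t, Torus.eGradNormSq (P s)) +
        ∫⁻ s in Ioo 0 t, FluidPDE.Torus.tailGradNormSq M (u s) := by
    rw [← lintegral_add_left' hmeasP]
    refine setLIntegral_congr_fun measurableSet_Ioo fun s hs => ?_
    exact eGradNormSq_eq_add_tailGradNormSq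
      ((hmem s ⟨hs.1.le, hs.2.le.trans ht.2⟩).integrable one_le_two) M
  have hDfin : ∫⁻ s in Ioo 0 t, Torus.eGradNormSq (u s) ≠ ⊤ :=
    ((lintegral_mono' hle le_rfl).trans_lt hu.lintegral_eGradNormSq_lt_top).ne
  have hPfin : ∫⁻ s in Ioo 0 t, Torus.eGradNormSq (P s) ≠ ⊤ :=
    ne_top_of_le_ne_top hDfin (hDsplit ▸ le_self_add)
  have hTfin : ∫⁻ s in Ioo 0 t, FluidPDE.Torus.tailGradNormSq M (u s) ≠ ⊤ :=
    ne_top_of_le_ne_top hDfin (hDsplit ▸ le_add_self)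
  have hDreal : (∫⁻ s in Ioo 0 t, Torus.eGradNormSq (u s)).toReal =
      (∫⁻ s in Ioo 0 t, Torus.eGradNormSq (P s)).toReal +
        (∫⁻ s in Ioo 0 t, FluidPDE.Torus.tailGradNormSq M (u s)).toReal := by
    rw [hDsplit, ENNReal.toReal_add hPfin hTfin]
  have hPreal : (∫⁻ s in Ioo 0 t, Torus.eGradNormSq (P s)).toReal =
      ∫ s in Ioc 0 t, (Torus.eGradNormSq (P s)).toReal := by
    have hfinN : ∀ᵐ s ∂(volume.restrict (Ioo 0 t)), Torus.eGradNormSq (P s) < ⊤ :=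
      ae_of_all _ fun s => Torus.eGradNormSq_lt_top (Torus.isSmooth_fourierTruncate M _)
    rw [← integral_toReal hmeasP hfinN, setIntegral_congr_set Ioo_ae_eq_Ioc]
  -- ### (5) Pythagoras at `t` and at `0`
  have hQt := kineticEnergy_highBand_eq hut M
  have hQ0 := kineticEnergy_highBand_eq hu₀ M
  -- ### (6) the right-hand side integrand, slice-wise
  have hRHS : ∫ s in Ioc 0 t, ((∫ x, ⟪f s x, u s x - P s x⟫) -
      ∫ x, ⟪u s x - P s x, Torus.convect (u s) (P s) x⟫) =
      (∫ s in Ioc 0 t, ∫ x, ⟪f s x, u s x⟫) - (∫ s in Ioc 0 t, ∫ x, ⟪f s x, P s x⟫) -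
        ∫ s in Ioc 0 t, ∫ x, ⟪u s x, Torus.convect (u s) (P s) x⟫ := by
    have hae : ∀ᵐ s ∂(volume.restrict (Ioc 0 t)), ((∫ x, ⟪f s x, u s x - P s x⟫) -
        ∫ x, ⟪u s x - P s x, Torus.convect (u s) (P s) x⟫) =
        ((∫ x, ⟪f s x, u s x⟫) - ∫ x, ⟪f s x, P s x⟫) -
          ∫ x, ⟪u s x, Torus.convect (u s) (P s) x⟫ := by
      filter_upwards [hfs2, ae_restrict_mem measurableSet_Ioc] with s hfs' hs
      have hus : MemLp (u s) 2 volume := hmem s ⟨hs.1.le, hs.2.trans ht.2⟩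
      have hPs : MemLp (P s) 2 volume := Torus.memLp_fourierTruncate M (u s) 2
      have hdiv : Torus.IsWeaklyDivFree (u s) := hu.isWeaklyDivFree_of_mem_Ioc ⟨hs.1, hs.2.trans ht.2⟩
      rw [← integral_inner_convect_fourierTruncate_self_eq_highBand hus hdiv M,
        ← integral_sub (FluidPDE.integrable_inner_of_memLp_two hfs' hus)
          (FluidPDE.integrable_inner_of_memLp_two hfs' hPs)]
      congr 1
      refine integral_congr_ae (ae_of_all _ fun x => ?_)
      simp only [inner_sub_right]
    have hWP' : Integrable (fun s => ∫ x, ⟪f s x, P s x⟫) (volume.restrict (Ioc 0 t)) := hWP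
    have h2 : Integrable (fun s => (∫ x, ⟪f s x, u s x⟫) - ∫ x, ⟪f s x, P s x⟫)
        (volume.restrict (Ioc 0 t)) := hWu.sub hWP'
    rw [integral_congr_ae hae, integral_sub h2 hC, integral_sub hWu hWP']
  -- ### (7) assemble
  rw [hRHS, hQt, hQ0]
  rw [hWu_eq, hDreal, hPreal] at hE
  rw [hId'] at hId
  nlinarith [hE, hId]

/-- **The dissipation of the budget dominates the high-band energy in time** (`ℝ≥0∞` form, no
measurability needed): `4π²(M²+1) ∫₀ᵗ ∫⁻‖Q_M u(s)‖ₑ² ds ≤ ∫₀ᵗ tail_M(u(s)) ds` along any family of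
`L²` slices. [folklore] -/
theorem lintegral_highBand_le_lintegral_tail {t : ℝ} (hmem : ∀ s ∈ Ioo 0 t, MemLp (u s) 2 volume)
    (M : ℕ) :
    ENNReal.ofReal (4 * Real.pi ^ 2) * ENNReal.ofReal ((M : ℝ) ^ 2 + 1) *
        ∫⁻ s in Ioo 0 t, ∫⁻ x, ‖Torus.fourierTruncate M (u s) x - u s x‖ₑ ^ 2 ≤
      ∫⁻ s in Ioo 0 t, FluidPDE.Torus.tailGradNormSq M (u s) := by
  rw [← lintegral_const_mul' _ _ (ENNReal.mul_ne_top ENNReal.ofReal_ne_top ENNReal.ofReal_ne_top)]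
  refine setLIntegral_mono' measurableSet_Ioo fun s hs => ?_
  exact FluidPDE.Torus.lintegral_enorm_sq_fourierTruncate_sub_le (hmem s hs) M

end LerayHopf


end Summit.NavierStokesRegularity.FluidComputer.TorusHighBandFluxCeiling
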